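import Summits.ABC.IUTFork.Conditional.Layer5OfSV09
import Literature.IUT.HodgeTheaters.StableCurveTemperedDataOfSpecialFibrePrintedLaws
import Literature.IUT.HodgeTheaters.InitialThetaDataTorsionMonodromyUnramified
import Literature.IUT.HodgeTheaters.PuncturedEllipticCoveringsCor12IotaLawOfLaws
import Literature.IUT.HodgeTheaters.PuncturedEllipticCoveringsArrowClaimsOfModLCuspLaws
import HarnessLib

/-!
# Layer-5 certificate, ADDITIVE PART v0.10 — §6 at the genuine kit with the UNRAMIFIED torsion-monodromy datum (`hI` becomes a record field);
# the most-primitive §2 grounding with the abelianisation laws in PRINTED form (β″); Cor 1.2 v6 with `hι'` grounded on abc-iut-L5-t1's cusp laws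
# (director-abc (C2); plan/L5/LAYER5-CERT-SPEC.md §7; abc-iut-L5-lead gen 6 RULINGS #69, #70 (2)(3)(5); writer abc-iut-L5-d1 gen 6)

cert L5 v0.10 additive part (one module, PROOF-ONLY: no `def`, no `instance`, no `axiom`, no `sorry`, no `notation`; every input BY NAME; nothing of
v0–v0.9 is touched).  THREE theorems, then the top `layer5_of_S_v10`:

* (K′) `layer5_held_sec6_v10_genuineKit_unramified` — v0.9's (K) (the four §6 held rows at the GENUINE kit `D.baseKitOfTorsionMonodromy …`, abc-iut-L5-t4
  p446463) with the datum `M' : D.UnramifiedTorsionMonodromy` (abc-iut-L5-t8 g7 `InitialThetaDataTorsionMonodromyUnramified` p448163 = t8's v1 structure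
  EXTENDED by the printed field `tau_inertia`, §1 p.37; GAP-LEDGER G-L5d5g6-1 v-next field), so the law `hI` IS `M'.tau_inertia_ε1` and leaves the list
  (RULINGS #70 (2)); and with abc-iut-L5-t1's SWAP RECIPE (13:31:05Z; «hA re-grounding» 8/8 ✓, p448117 `arrowCoveringClaims_pe_of_modLCuspLaws`)
  the standing §1 binder `hA : ArrowCoveringClaims` (13 clauses about the construction) is REPLACED by `hL : ModLCuspLaws` (t1's record of SIX printed cusp laws
  mod `l`, p446054).  LAWS `hS hL ΛBad` (3; v0.9: 4 = `hS hA hI ΛBad`), DATA `D CG M' B`, «+1 record-law in `M'`».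

* (β″) `layer5_held_sec2_v10_prop24_piData_printed` — v0.8's (β′) (`hINV` discharged) with `hstf` ↦ `hTF` ([Config] Rmk 1.2.2 in printed form on `Δ̂_X`:
  «Σ-characters of an open subgroup detect `h` iff they detect `hⁿ`») and `hspec` ↦ `hab` («characters of `N_i` into finite abelian Σ-groups kill
  `Ker(adm_i)`» on L3's record), via abc-iut-L5-t11's ONE-CALL closer `StableCurveTemperedData.OfSpecialFibre.prop24_cor25_ofPiData_of_printedLaws`
  (`StableCurveTemperedDataOfSpecialFibrePrintedLaws` p447838, over abc-iut-f-193 p445986/p445247, abc-iut-w5-d119 `Prop24Tower.specializationAb_of_levelCharacters`,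
  abc-iut-w4-d055 `stronglyTorsionFreeSigma_of_torsionFreeAb`).  LAW 12 (h22 hHstab hA hB hv htp hhat hTF hA3 hab hadm hLev; count = (β′)), every law a
  statement about `X.DeltaHat` / `T.N i` / `T.adm i` / `T.admKer i` / the level charts; data T P Λv E src tgt c₁ c₂; side hΛv, cusp `x`.
* (C6) `layer5_held_cor12_v6` — v0.9's (C5) with the classical law `hι'` GROUNDED on abc-iut-L5-t1's RECORD of printed §1 cusp laws mod `l`
  `L' : D'.geom.pe.ModLCuspLaws` (p446054) + the (rel)-type inclusion `hIH'` + the rank law `hrank'` («`[Δ'_X : H'] = l'²`»), via abc-iut-L5-d4 g8's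
  `pe_characteristicNatureOfCoverings_viaX_of_laws` (`…Cor12IotaLawOfLaws` p448270), AND the two printed-claims binders `h h'` (`ArrowCoveringClaims`)
  DERIVED from t1's law records `hL`/`L'` and the cusp interfaces (SWAP RECIPE, p448117).  LAW 13 → 14 named (`hL L' h0 h0' hΔ hΔ' htf huniq' hext hextC hA hA'
  hIH' hrank'` — every one a printed law about standard objects or an L4 node by name); most-reduced Cor 1.2 count unchanged (v0's abstract form).

CENSUS v0.10 (BINDER CONVENTION of RULINGS #40 (1); HEADLINE RULE of RULINGS #61/#69): headline **§6 = 3 {hS, hL, ΛBad} (+1 record-law `tau_inertia`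
in `M'`; `hL` = t1's 6-law record replacing the 13-clause `hA`)** [v0.9: 4; v0: 1 kit-relative]; hence most-reduced **CONE 37 → 36 (+2 record-laws in `P`, +1 in `M'`) · FACT 0 · side 15 · NV 3**; the (α) route
stays the most-reduced §2 count ((β″) = 12 printed-form laws, alternative); Cor 1.2 alternative (C6) = 14 named laws (`hι'` split, `h h'` derived; v0's abstract
form stays most-reduced).  NV by name: `M'` inhabited by t8's `exists_unramifiedTorsionMonodromy` [regeom; degenerate at the inertia]; {M', hA} jointly at ONE
datum = abc-iut-w4-d077 (p448379, pending); `B` t4 p447892 [stand-in]; `ΛBad` d5.  Nodes 139 unchanged.  S-FREE.  Post-freeze-additive modules imported for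
the closers (not cone members): StableCurveTemperedDataOfSpecialFibrePrintedLaws (p447838, proof-only), InitialThetaDataTorsionMonodromyUnramified (p448163,
DEF-BEARING: the structure `UnramifiedTorsionMonodromy` of abc-iut-L5-t8, used as the datum TYPE and through `tau_inertia_ε1`),
PuncturedEllipticCoveringsCor12IotaLawOfLaws (p448270, proof-only), PuncturedEllipticCoveringsArrowClaimsOfModLCuspLaws (p448117,
proof-only, abc-iut-L5-t1).

Mochizuki, *Inter-universal Teichmüller theory I: construction of Hodge theaters*, kurims manuscript (May 2020) [cite: Mochizuki2012]
(D-0012 claim key; series status DISPUTED; pages = kurims preprint render IUTchI-kurims-url-690e7b3c6199); Mochizuki, *Semi-graphs of anabelioids*,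
Publ. RIMS 42 (2006) [cite: MochizukiSemiAnbd2006, Ex 3.10 pp.44-45].  HONEST FRAMING: nothing in this file asserts that abc is proved or refuted or takes a
side on [IUTchIII] Cor. 3.12 (nor on [IUTchI]); every binder is an ASSUMPTION LABEL; the record `P` is ORIGIN DATA (nothing asserts that a given curve admits
it); typed ≠ inhabited ≠ discharged; indexed ≠ endorsed; establishment = OUR kernel check only.
-/

namespace Summit.ABC.IUTFork.Conditional

open CategoryTheory Literature.IUT.HodgeTheaters ProfiniteGrp ProfiniteGrp.ProfiniteCompletion
open scoped Pointwise
universe u v w u'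

section Sec6V10

/-! ## §6 held rows AT THE GENUINE KIT with the UNRAMIFIED torsion-monodromy datum: `hI` becomes the datum's field (RULINGS #70 (2)) -/

/-- **Class (c), [IUTchI] §6 — HELD rows Prop 6.5 (i), 6.6 (ii), 6.6 (iii), 6.8 (i) AT THE GENUINE §6 BASE KIT, the torsion-monodromy datum in
its UNRAMIFIED v-next form** (abc-iut-L5-lead gen 6 RULINGS #70 (2): «binder weakening {Nonempty TorsionMonodromy, hI} ↦ {Nonempty
UnramifiedTorsionMonodromy} … v0.10+»).  As v0.9's `layer5_held_sec6_v9_genuineKit` (abc-iut-L5-t4's `baseKitOfTorsionMonodromy` p446463; `hβ`, `hsign`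
THEOREMS; `l ≠ 2` from `five_le_l`) but with the datum `M' : D.UnramifiedTorsionMonodromy` (abc-iut-L5-t8 g7, `InitialThetaDataTorsionMonodromyUnramified`
p448163: t8's v1 `TorsionMonodromy` EXTENDED by the printed field `tau_inertia` «the inertia groups of the cusps of `X̲` die in `Δ_E ⊗ ℤ/l`», §1 p.37
exact sequence — GAP-LEDGER G-L5d5g6-1's v-next FIELD), so that abc-iut-L5-d5's binder `hI` IS the datum's `M'.tau_inertia_ε1` and LEAVES the law list.
ALSO (abc-iut-L5-t1's SWAP RECIPE 13:31:05Z, «hA re-grounding» p448117 `arrowCoveringClaims_pe_of_modLCuspLaws`): the standing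
§1 binder `hA : ArrowCoveringClaims` (13 clauses about the CONSTRUCTION `jKer`, `Π_{X̲→}`, `Π_{C̲→}`) is REPLACED by `hL : D.geom.pe.ModLCuspLaws` (t1's record of
SIX printed laws about the standard objects `I_x` / `Δ_X̲^{ab} ⊗ ℤ/l` / `Δ_ε`, p446054) and DERIVED from it and `CG`.  BINDERS: DATA `D` `CG` `M'` `B` · LAWS `hS` ·
`hL` · `ΛBad` (3; v0.9: 4 with `hA`, `hI`) · `[Fact l.Prime]` = the datum's `l_prime` (not counted) — «+1 record-law in `M'`»
(`tau_inertia`, printed beside it, same convention as the record-laws of `P`).  NV (RULINGS #71 (4) wording): the binder set {CG, hS, M', hL, B, ΛBad} is jointly NV-PENDING (row «JOINT-NV-CG», abc-iut-w4-d077 stage B); single-binder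
witnesses: `M'` = abc-iut-L5-t8's `exists_unramifiedTorsionMonodromy` (regeom; [degenerate at the inertia]; a CG-UNINHABITABLE datum, card Cusp = 4 < l —
t8's finding adopted in RULINGS #71), `hL` = abc-iut-L5-t1's `ArrowModel.modLCuspLaws` (p448735, finite §1 model), `B` = NV #48 (abc-iut-L5-t4 p447892
[stand-in]), `ΛBad` = abc-iut-L5-d5's p446888 at the arrow stand-in; the CG-free subset {M, hA, hI} = w4-d077 stage A (p448379, pending) — inhabited ≠
discharged, and NO `Nonempty`/model conjunct enters the certificate until stage B lands.  Closers BY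
NAME as v0.9.  Nothing here asserts that abc is proved or refuted or takes a side on [IUTchIII] Cor. 3.12; a binder is an assumption label; typed ≠
inhabited ≠ discharged. -/
theorem layer5_held_sec6_v10_genuineKit_unramified
    {F : Type u} {K : Type v} {Fbar : Type w} [Field F] [NumberField F] [Field K] [NumberField K]
    [Algebra F K] [Field Fbar] [Algebra F Fbar] [Algebra K Fbar]
    {E : WeierstrassCurve F} [E.IsElliptic] {l : ℕ} {Pb : BadPlacePredicates K}
    (D : InitialThetaData F K Fbar E l Pb) [Fact l.Prime]
    -- DATA: cusp/Galois interface, torsion monodromy, bad-pair data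
    (CG : D.geom.pe.CuspGalois) (M' : D.UnramifiedTorsionMonodromy) (B : ∀ v, v ∈ D.indexCopyBad → D.BadPairAt v)
    -- LAWS: cusp-class normaliser stability, t1's SIX printed cusp laws mod `l` (`ModLCuspLaws`; `ArrowCoveringClaims` derived, p448117), bad-place arrow laws
    (hS : D.CuspClassesNormaliserStable) (hL : D.geom.pe.ModLCuspLaws)
    (ΛBad : ∀ v (h : v ∈ D.indexCopyBad), D.LocalArrowLaw CG hS (B v h).H) :
    ((∀ Bθ : (D.baseKitOfTorsionMonodromy CG hS M'.toTorsionMonodromy (D.arrowCoveringClaims_pe_of_modLCuspLaws CG hL)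
        M'.tau_inertia_ε1 B
        (fun v _ => D.localArrowLaw_L2_sign_local CG hS (D.arrowCoveringClaims_pe_of_modLCuspLaws CG hL) (D.decompAt v)) ΛBad).DThetaEllBridge, Bθ.InducesZeta) ∧
      ∀ Bθ : (D.baseKitOfTorsionMonodromy CG hS M'.toTorsionMonodromy (D.arrowCoveringClaims_pe_of_modLCuspLaws CG hL)
        M'.tau_inertia_ε1 B
        (fun v _ => D.localArrowLaw_L2_sign_local CG hS (D.arrowCoveringClaims_pe_of_modLCuspLaws CG hL) (D.decompAt v)) ΛBad).DThetaEllBridge, Bθ.XiGroupCompat) ∧  -- IUTchI:Prop6.5(i)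
    (∀ B₁ B₂ : (D.baseKitOfTorsionMonodromy CG hS M'.toTorsionMonodromy (D.arrowCoveringClaims_pe_of_modLCuspLaws CG hL)
        M'.tau_inertia_ε1 B
        (fun v _ => D.localArrowLaw_L2_sign_local CG hS (D.arrowCoveringClaims_pe_of_modLCuspLaws CG hL) (D.decompAt v)) ΛBad).DThetaEllBridge,
      PMBaseKit.DThetaEllBridge.IsoTorsor B₁ B₂) ∧  -- IUTchI:Prop6.6(ii)
    (∀ H₁ H₂ : (D.baseKitOfTorsionMonodromy CG hS M'.toTorsionMonodromy (D.arrowCoveringClaims_pe_of_modLCuspLaws CG hL)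
        M'.tau_inertia_ε1 B
        (fun v _ => D.localArrowLaw_L2_sign_local CG hS (D.arrowCoveringClaims_pe_of_modLCuspLaws CG hL) (D.decompAt v)) ΛBad).DThetaPMEllHT,
      PMBaseKit.DThetaPMEllHT.IsoTorsor H₁ H₂) ∧  -- IUTchI:Prop6.6(iii)
    (∀ H : (D.baseKitOfTorsionMonodromy CG hS M'.toTorsionMonodromy (D.arrowCoveringClaims_pe_of_modLCuspLaws CG hL)
        M'.tau_inertia_ε1 B
        (fun v _ => D.localArrowLaw_L2_sign_local CG hS (D.arrowCoveringClaims_pe_of_modLCuspLaws CG hL) (D.decompAt v)) ΛBad).DThetaPMEllHT,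
      PMBaseKit.DThetaPMEllHT.EllBridgeSymmetry H) :=  -- IUTchI:Prop6.8(i)
  ⟨⟨fun Bθ => PMBaseKit.DThetaEllBridge.inducesZeta Bθ,
    fun Bθ => PMBaseKit.DThetaEllBridge.xiGroupCompat_of_negCompatModel (by have := D.five_le_l; omega)
      (D.negCompatModel_baseKitOfTorsionMonodromy CG hS M'.toTorsionMonodromy (D.arrowCoveringClaims_pe_of_modLCuspLaws CG hL)
        M'.tau_inertia_ε1 B
      (fun v _ => D.localArrowLaw_L2_sign_local CG hS (D.arrowCoveringClaims_pe_of_modLCuspLaws CG hL) (D.decompAt v)) ΛBad) Bθ⟩,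
   D.isoTorsor_thetaEllBridge_baseKitOfTorsionMonodromy CG hS M'.toTorsionMonodromy (D.arrowCoveringClaims_pe_of_modLCuspLaws CG hL)
        M'.tau_inertia_ε1 B
      (fun v _ => D.localArrowLaw_L2_sign_local CG hS (D.arrowCoveringClaims_pe_of_modLCuspLaws CG hL) (D.decompAt v)) ΛBad,
   D.isoTorsor_thetaPMEllHT_baseKitOfTorsionMonodromy CG hS M'.toTorsionMonodromy (D.arrowCoveringClaims_pe_of_modLCuspLaws CG hL)
        M'.tau_inertia_ε1 B
      (fun v _ => D.localArrowLaw_L2_sign_local CG hS (D.arrowCoveringClaims_pe_of_modLCuspLaws CG hL) (D.decompAt v)) ΛBad,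
   D.ellBridgeSymmetry_baseKitOfTorsionMonodromy CG hS M'.toTorsionMonodromy (D.arrowCoveringClaims_pe_of_modLCuspLaws CG hL)
        M'.tau_inertia_ε1 B
      (fun v _ => D.localArrowLaw_L2_sign_local CG hS (D.arrowCoveringClaims_pe_of_modLCuspLaws CG hL) (D.decompAt v)) ΛBad⟩

end Sec6V10

section Sec2V10

open Topology Literature.AnabelianGeometry.SemiGraphs Literature.AnabelianGeometry.SemiGraphs.ProfiniteSemiGraph

/-! ## §2 (β″): the most-primitive §2 grounding with the two abelianisation laws in PRINTED form (abc-iut-L5-t11 `…PrintedLaws`) -/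

/-- **(β″): v0.8's `layer5_held_sec2_v8_prop24_piData_complete` ((β′): Prop 2.4 (i)/(ii) unfolded to their per-level inputs over L3's origin-data
record `P`, `hINV` discharged) with the two ABELIANISATION laws re-stated in PRINTED form** via abc-iut-L5-t11's ONE-CALL closer
`StableCurveTemperedData.OfSpecialFibre.prop24_cor25_ofPiData_of_printedLaws` (`StableCurveTemperedDataOfSpecialFibrePrintedLaws` p447838, over f-193
p445986/p445247, w5-d119's `Prop24Tower.specializationAb_of_levelCharacters`, w4-d055's `stronglyTorsionFreeSigma_of_torsionFreeAb`): `hstf`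
(`StronglyTorsionFreeSigma` at the datum) ↦ `hTF` = [Config] Rmk 1.2.2 in printed form on `Δ̂_X` («Σ-characters of an open subgroup detect `h` iff they
detect `hⁿ`»), `hspec` (`SpecializationAb` of the tower) ↦ `hab` = «characters of `N_i` into finite abelian Σ-groups kill `Ker(adm_i)`» on L3's record —
every law now a statement about `X.DeltaHat` / `T.N i` / `T.adm i` / `T.admKer i` / the level charts.  LAW binders h22 · hHstab · hA · hB · hv · htp · hhat ·
hTF · hA3 · hab · hadm · hLev = 12 (count unchanged vs (β′)); data T, P, Λv, E, src, tgt, c₁, c₂; side hΛv, cusp `x`.  The (α) route stays the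
most-reduced §2 count; (β″) is the most-primitive, printed-form grounding.  Nothing here asserts that abc is proved or refuted or takes a side on [IUTchIII]
Cor. 3.12; a binder is an assumption label; typed ≠ discharged. -/
theorem layer5_held_sec2_v10_prop24_piData_printed
    {p : ℕ} [Fact p.Prime] (X : Literature.AnabelianGeometry.SemiGraphs.TemperedCurve p) (d : X.GroupLevelData)
    (S : Literature.AnabelianGeometry.SemiGraphs.SpecialFibreData (X.toTemperedArithmeticGroup d)) (h36 : S.Gc.Prop36Hypotheses)
    (Sigma SigmaHat : Set ℕ) (hsub : Sigma ⊆ SigmaHat) (hne : Sigma.Nonempty)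
    (hprime : ∀ q ∈ SigmaHat, q.Prime) (hp : p ∉ Sigma) (TpH : Subgroup S.chart.G)
    (cuspMeetsH : {x : X.Pt // X.IsCusp x} → Prop) (x : {x : X.Pt // X.IsCusp x})
    (T : SpecialFibreTower X.DeltaTemp) (P : SpecialFibreTower.PiData X d S T)
    (h22 : (StableCurveTemperedData.ofSpecialFibre X d S h36 Sigma SigmaHat hsub hne hprime hp TpH ((TpH.map (TemperedGraphGroupData.exists_completion_of_prop36 S.Gc h36 S.chart).choose_spec.choose.toMonoidHom).topologicalClosure) (Subgroup.le_topologicalClosure _) cuspMeetsH).graph.CommensuratorsOfDecompositionSubgroups)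
    (hHstab : ∀ g : X.PiTemp, ∃ t : S.chart.G,
      TpH.map (S.autOfConj P.admissibleKer_normal_pi g).toMulEquiv.toMonoidHom = MulAut.conj t • TpH)
    (hA : (∃ l ∈ SigmaHat, l ∉ Sigma ∧ l ≠ p) →
      ∀ (i : ℕ) (a : (StableCurveTemperedData.ofSpecialFibre X d S h36 Sigma SigmaHat hsub hne hprime hp TpH ((TpH.map (TemperedGraphGroupData.exists_completion_of_prop36 S.Gc h36 S.chart).choose_spec.choose.toMonoidHom).topologicalClosure) (Subgroup.le_topologicalClosure _) cuspMeetsH).DeltaHat),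
        (∀ y ∈ ((StableCurveTemperedData.OfSpecialFibre.towerOfSpecialFibreTower X d T Sigma SigmaHat hsub hne hprime S h36 hp TpH ((TpH.map (TemperedGraphGroupData.exists_completion_of_prop36 S.Gc h36 S.chart).choose_spec.choose.toMonoidHom).topologicalClosure) (Subgroup.le_topologicalClosure _) cuspMeetsH).Jhat i).subgroupOf (StableCurveTemperedData.ofSpecialFibre X d S h36 Sigma SigmaHat hsub hne hprime hp TpH ((TpH.map (TemperedGraphGroupData.exists_completion_of_prop36 S.Gc h36 S.chart).choose_spec.choose.toMonoidHom).topologicalClosure) (Subgroup.le_topologicalClosure _) cuspMeetsH).DeltaHat, y ∈ (StableCurveTemperedData.ofSpecialFibre X d S h36 Sigma SigmaHat hsub hne hprime hp TpH ((TpH.map (TemperedGraphGroupData.exists_completion_of_prop36 S.Gc h36 S.chart).choose_spec.choose.toMonoidHom).topologicalClosure) (Subgroup.le_topologicalClosure _) cuspMeetsH).ρHat.ker → a * y = y * a) →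
        a ∈ ((StableCurveTemperedData.OfSpecialFibre.towerOfSpecialFibreTower X d T Sigma SigmaHat hsub hne hprime S h36 hp TpH ((TpH.map (TemperedGraphGroupData.exists_completion_of_prop36 S.Gc h36 S.chart).choose_spec.choose.toMonoidHom).topologicalClosure) (Subgroup.le_topologicalClosure _) cuspMeetsH).Jhat i).subgroupOf (StableCurveTemperedData.ofSpecialFibre X d S h36 Sigma SigmaHat hsub hne hprime hp TpH ((TpH.map (TemperedGraphGroupData.exists_completion_of_prop36 S.Gc h36 S.chart).choose_spec.choose.toMonoidHom).topologicalClosure) (Subgroup.le_topologicalClosure _) cuspMeetsH).DeltaHat)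
    (hB : SigmaHat = {q | q.Prime} →
      ∀ (i : ℕ) (a : (StableCurveTemperedData.ofSpecialFibre X d S h36 Sigma SigmaHat hsub hne hprime hp TpH ((TpH.map (TemperedGraphGroupData.exists_completion_of_prop36 S.Gc h36 S.chart).choose_spec.choose.toMonoidHom).topologicalClosure) (Subgroup.le_topologicalClosure _) cuspMeetsH).DeltaHat),
        (∀ y ∈ ((StableCurveTemperedData.OfSpecialFibre.towerOfSpecialFibreTower X d T Sigma SigmaHat hsub hne hprime S h36 hp TpH ((TpH.map (TemperedGraphGroupData.exists_completion_of_prop36 S.Gc h36 S.chart).choose_spec.choose.toMonoidHom).topologicalClosure) (Subgroup.le_topologicalClosure _) cuspMeetsH).Jhat i).subgroupOf (StableCurveTemperedData.ofSpecialFibre X d S h36 Sigma SigmaHat hsub hne hprime hp TpH ((TpH.map (TemperedGraphGroupData.exists_completion_of_prop36 S.Gc h36 S.chart).choose_spec.choose.toMonoidHom).topologicalClosure) (Subgroup.le_topologicalClosure _) cuspMeetsH).DeltaHat, y ∈ (StableCurveTemperedData.ofSpecialFibre X d S h36 Sigma SigmaHat hsub hne hprime hp TpH ((TpH.map (TemperedGraphGroupData.exists_completion_of_prop36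 S.Gc h36 S.chart).choose_spec.choose.toMonoidHom).topologicalClosure) (Subgroup.le_topologicalClosure _) cuspMeetsH).ρHat.ker → a * y = y * a) →
        a ∈ ((StableCurveTemperedData.OfSpecialFibre.towerOfSpecialFibreTower X d T Sigma SigmaHat hsub hne hprime S h36 hp TpH ((TpH.map (TemperedGraphGroupData.exists_completion_of_prop36 S.Gc h36 S.chart).choose_spec.choose.toMonoidHom).topologicalClosure) (Subgroup.le_topologicalClosure _) cuspMeetsH).Jhat i).subgroupOf (StableCurveTemperedData.ofSpecialFibre X d S h36 Sigma SigmaHat hsub hne hprime hp TpH ((TpH.map (TemperedGraphGroupData.exists_completion_of_prop36 S.Gc h36 S.chart).choose_spec.choose.toMonoidHom).topologicalClosure) (Subgroup.le_topologicalClosure _) cuspMeetsH).DeltaHat)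
    (hv : ((StableCurveTemperedData.ofSpecialFibre X d S h36 Sigma SigmaHat hsub hne hprime hp TpH ((TpH.map (TemperedGraphGroupData.exists_completion_of_prop36 S.Gc h36 S.chart).choose_spec.choose.toMonoidHom).topologicalClosure) (Subgroup.le_topologicalClosure _) cuspMeetsH).graph.HatH : Set (StableCurveTemperedData.ofSpecialFibre X d S h36 Sigma SigmaHat hsub hne hprime hp TpH ((TpH.map (TemperedGraphGroupData.exists_completion_of_prop36 S.Gc h36 S.chart).choose_spec.choose.toMonoidHom).topologicalClosure) (Subgroup.le_topologicalClosure _) cuspMeetsH).graph.Hat) ∩ Set.range (StableCurveTemperedData.ofSpecialFibre X d S h36 Sigma SigmaHat hsub hne hprime hp TpH ((TpH.map (TemperedGraphGroupData.exists_completion_of_prop36 S.Gc h36 S.chart).choose_spec.choose.toMonoidHom).topologicalClosure) (Subgroup.le_topologicalClosure _) cuspMeetsH).graph.ι = (StableCurveTemperedData.ofSpecialFibre X d S h36 Sigma SigmaHat hsub hne hprime hp TpH ((TpH.map (TemperedGraphGroupData.exists_completion_of_prop36 S.Gc h36 S.chart).choose_spec.choose.toMonoidHom).topologicalClosure) (Subgroup.le_topologicalClosure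 _) cuspMeetsH).graph.ι '' (StableCurveTemperedData.ofSpecialFibre X d S h36 Sigma SigmaHat hsub hne hprime hp TpH ((TpH.map (TemperedGraphGroupData.exists_completion_of_prop36 S.Gc h36 S.chart).choose_spec.choose.toMonoidHom).topologicalClosure) (Subgroup.le_topologicalClosure _) cuspMeetsH).graph.TpH)
    (htp : ∀ x : (StableCurveTemperedData.ofSpecialFibre X d S h36 Sigma SigmaHat hsub hne hprime hp TpH ((TpH.map (TemperedGraphGroupData.exists_completion_of_prop36 S.Gc h36 S.chart).choose_spec.choose.toMonoidHom).topologicalClosure) (Subgroup.le_topologicalClosure _) cuspMeetsH).Cusp, (StableCurveTemperedData.ofSpecialFibre X d S h36 Sigma SigmaHat hsub hne hprime hp TpH ((TpH.map (TemperedGraphGroupData.exists_completion_of_prop36 S.Gc h36 S.chart).choose_spec.choose.toMonoidHom).topologicalClosure) (Subgroup.le_topologicalClosure _) cuspMeetsH).cuspMeetsH x →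
      ∃ t : (StableCurveTemperedData.ofSpecialFibre X d S h36 Sigma SigmaHat hsub hne hprime hp TpH ((TpH.map (TemperedGraphGroupData.exists_completion_of_prop36 S.Gc h36 S.chart).choose_spec.choose.toMonoidHom).topologicalClosure) (Subgroup.le_topologicalClosure _) cuspMeetsH).graph.Tp, ((StableCurveTemperedData.ofSpecialFibre X d S h36 Sigma SigmaHat hsub hne hprime hp TpH ((TpH.map (TemperedGraphGroupData.exists_completion_of_prop36 S.Gc h36 S.chart).choose_spec.choose.toMonoidHom).topologicalClosure) (Subgroup.le_topologicalClosure _) cuspMeetsH).inertiaTp x).map (StableCurveTemperedData.ofSpecialFibre X d S h36 Sigma SigmaHat hsub hne hprime hp TpH ((TpH.map (TemperedGraphGroupData.exists_completion_of_prop36 S.Gc h36 S.chart).choose_spec.choose.toMonoidHom).topologicalClosure) (Subgroup.le_topologicalClosure _) cuspMeetsH).ρTp ≤ MulAut.conj t • (StableCurveTemperedData.ofSpecialFibre X d S h36 Sigma SigmaHat hsub hne hprime hp TpH ((TpH.map (TemperedGraphGroupData.exists_completion_of_prop36 S.Gc h36 S.chart).choose_spec.choose.toMonoidHom).topologicalClosure)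 (Subgroup.le_topologicalClosure _) cuspMeetsH).graph.TpH)
    (hhat : ∀ x : (StableCurveTemperedData.ofSpecialFibre X d S h36 Sigma SigmaHat hsub hne hprime hp TpH ((TpH.map (TemperedGraphGroupData.exists_completion_of_prop36 S.Gc h36 S.chart).choose_spec.choose.toMonoidHom).topologicalClosure) (Subgroup.le_topologicalClosure _) cuspMeetsH).Cusp,
      (∃ g : (StableCurveTemperedData.ofSpecialFibre X d S h36 Sigma SigmaHat hsub hne hprime hp TpH ((TpH.map (TemperedGraphGroupData.exists_completion_of_prop36 S.Gc h36 S.chart).choose_spec.choose.toMonoidHom).topologicalClosure) (Subgroup.le_topologicalClosure _) cuspMeetsH).graph.Hat, (((StableCurveTemperedData.ofSpecialFibre X d S h36 Sigma SigmaHat hsub hne hprime hp TpH ((TpH.map (TemperedGraphGroupData.exists_completion_of_prop36 S.Gc h36 S.chart).choose_spec.choose.toMonoidHom).topologicalClosure) (Subgroup.le_topologicalClosure _) cuspMeetsH).inertiaTp x).map (StableCurveTemperedData.ofSpecialFibre X d S h36 Sigma SigmaHat hsub hne hprime hp TpH ((TpH.map (TemperedGraphGroupData.exists_completion_of_prop36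 S.Gc h36 S.chart).choose_spec.choose.toMonoidHom).topologicalClosure) (Subgroup.le_topologicalClosure _) cuspMeetsH).ρTp).map (StableCurveTemperedData.ofSpecialFibre X d S h36 Sigma SigmaHat hsub hne hprime hp TpH ((TpH.map (TemperedGraphGroupData.exists_completion_of_prop36 S.Gc h36 S.chart).choose_spec.choose.toMonoidHom).topologicalClosure) (Subgroup.le_topologicalClosure _) cuspMeetsH).graph.ι ≤ MulAut.conj g • (StableCurveTemperedData.ofSpecialFibre X d S h36 Sigma SigmaHat hsub hne hprime hp TpH ((TpH.map (TemperedGraphGroupData.exists_completion_of_prop36 S.Gc h36 S.chart).choose_spec.choose.toMonoidHom).topologicalClosure) (Subgroup.le_topologicalClosure _) cuspMeetsH).graph.HatH) → (StableCurveTemperedData.ofSpecialFibre X d S h36 Sigma SigmaHat hsub hne hprime hp TpH ((TpH.map (TemperedGraphGroupData.exists_completion_of_prop36 S.Gc h36 S.chart).choose_spec.choose.toMonoidHom).topologicalClosure) (Subgroup.le_topologicalClosure _) cuspMeetsH).cuspMeetsH x)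
    -- Prop 2.4 (i) inputs (p.50 l.25 – p.51 l.10): [Config] Rmk 1.2.2
    (hTF : ∀ H : Subgroup X.DeltaHat, IsOpen (H : Set X.DeltaHat) →
      ∀ (h : H) (n : ℕ), n ≠ 0 →
        SigmaCharDetects Set.univ H h →
          SigmaCharDetects Set.univ H (h ^ n))
    (Λv : ∀ i, (T.Gc i).graph.Vertex → Subgroup (T.chart i).G)
    (hΛv : ∀ i v, Λv i v ∈ verticialSubgroups (T.chart i) v)
    -- DATA: level node data (nodes of the level graphs with their end-points and branch conjugators)
    (E : ℕ → Type) (src tgt : ∀ i, E i → (T.Gc i).graph.Vertex) (c₁ c₂ : ∀ i, E i → (T.chart i).G)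
    -- (A3) = [AbsTopII] Prop 1.3 (iv) / [NodNon] Lem 1.9 (ii), level form (p.45 l.35–39 at each `𝔾_{J_i}`)
    (hA3 : ∀ i (v w : (T.Gc i).graph.Vertex)
      (g h : (StableCurveTemperedData.OfSpecialFibre.levelGraph X T Sigma SigmaHat hsub hne hprime i).Hat),
      MulAut.conj g • (Λv i v).map (StableCurveTemperedData.OfSpecialFibre.levelGraph X T Sigma SigmaHat hsub hne hprime i).ι ⊓
          MulAut.conj h • (Λv i w).map (StableCurveTemperedData.OfSpecialFibre.levelGraph X T Sigma SigmaHat hsub hne hprime i).ι ≠ ⊥ →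
        (v = w ∧ g⁻¹ * h ∈ (Λv i v).map (StableCurveTemperedData.OfSpecialFibre.levelGraph X T Sigma SigmaHat hsub hne hprime i).ι) ∨
        ∃ (e : E i) (k : (StableCurveTemperedData.OfSpecialFibre.levelGraph X T Sigma SigmaHat hsub hne hprime i).Hat),
          ∃ p ∈ (Λv i (src i e)).map (StableCurveTemperedData.OfSpecialFibre.levelGraph X T Sigma SigmaHat hsub hne hprime i).ι,
          ∃ q ∈ (Λv i (tgt i e)).map (StableCurveTemperedData.OfSpecialFibre.levelGraph X T Sigma SigmaHat hsub hne hprime i).ι,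
            (src i e = v ∧ tgt i e = w ∧
                g = k * (StableCurveTemperedData.OfSpecialFibre.levelGraph X T Sigma SigmaHat hsub hne hprime i).ι (c₁ i e) * p ∧
                h = k * (StableCurveTemperedData.OfSpecialFibre.levelGraph X T Sigma SigmaHat hsub hne hprime i).ι (c₂ i e) * q) ∨
            (src i e = w ∧ tgt i e = v ∧
                h = k * (StableCurveTemperedData.OfSpecialFibre.levelGraph X T Sigma SigmaHat hsub hne hprime i).ι (c₁ i e) * p ∧
                g = k * (StableCurveTemperedData.OfSpecialFibre.levelGraph X T Sigma SigmaHat hsub hne hprime i).ι (c₂ i e) * q))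
    -- the `p ∉ Σ` specialisation half and the inverse-limit detection of the level data (Prop 2.4 (i) proof, p.50 l.40 – p.51 l.10)
    (hab : ∀ (i : ℕ) (A : Type) [CommGroup A] [Finite A] (χ : T.N i →* A),
      IsOpen ((χ.ker : Subgroup (T.N i)) : Set (T.N i)) →
      (∀ q : ℕ, q.Prime → q ∣ Nat.card A → q ∈ Sigma) → (T.adm i).toMonoidHom.ker ≤ χ.ker)
    (hadm : ∀ U ∈ 𝓝 (1 : ↥X.DeltaTemp), ∃ j, ((T.admKer j : Subgroup ↥X.DeltaTemp) : Set ↥X.DeltaTemp) ⊆ U)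
    (hLev : (StableCurveTemperedData.OfSpecialFibre.qTowerOfSpecialFibreTower X T d S h36 Sigma SigmaHat hsub hne hprime hp TpH ((TpH.map (TemperedGraphGroupData.exists_completion_of_prop36 S.Gc h36 S.chart).choose_spec.choose.toMonoidHom).topologicalClosure) (Subgroup.le_topologicalClosure _) cuspMeetsH P.admKer_normal_pi).LevelObservation) :
    (StableCurveTemperedData.ofSpecialFibre X d S h36 Sigma SigmaHat hsub hne hprime hp TpH ((TpH.map (TemperedGraphGroupData.exists_completion_of_prop36 S.Gc h36 S.chart).choose_spec.choose.toMonoidHom).topologicalClosure) (Subgroup.le_topologicalClosure _) cuspMeetsH).Cor23i ∧ (StableCurveTemperedData.ofSpecialFibre X d S h36 Sigma SigmaHat hsub hne hprime hp TpH ((TpH.map (TemperedGraphGroupData.exists_completion_of_prop36 S.Gc h36 S.chart).choose_spec.choose.toMonoidHom).topologicalClosure) (Subgroup.le_topologicalClosure _) cuspMeetsH).Cor23ii ∧ (StableCurveTemperedData.ofSpecialFibre X d S h36 Sigma SigmaHat hsub hne hprime hp TpH ((TpH.map (TemperedGraphGroupData.exists_completion_of_prop36 S.Gc h36 S.chart).choose_spec.choose.toMonoidHom).topologicalClosure)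 (Subgroup.le_topologicalClosure _) cuspMeetsH).Cor23iii ∧ (StableCurveTemperedData.ofSpecialFibre X d S h36 Sigma SigmaHat hsub hne hprime hp TpH ((TpH.map (TemperedGraphGroupData.exists_completion_of_prop36 S.Gc h36 S.chart).choose_spec.choose.toMonoidHom).topologicalClosure) (Subgroup.le_topologicalClosure _) cuspMeetsH).Cor23iv ∧ (StableCurveTemperedData.ofSpecialFibre X d S h36 Sigma SigmaHat hsub hne hprime hp TpH ((TpH.map (TemperedGraphGroupData.exists_completion_of_prop36 S.Gc h36 S.chart).choose_spec.choose.toMonoidHom).topologicalClosure) (Subgroup.le_topologicalClosure _) cuspMeetsH).Cor23v ∧ (StableCurveTemperedData.ofSpecialFibre X d S h36 Sigma SigmaHat hsub hne hprime hp TpH ((TpH.map (TemperedGraphGroupData.exists_completion_of_prop36 S.Gc h36 S.chart).choose_spec.choose.toMonoidHom).topologicalClosure) (Subgroup.le_topologicalClosure _) cuspMeetsH).Cor23vi ∧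
    ((StableCurveTemperedData.ofSpecialFibre X d S h36 Sigma SigmaHat hsub hne hprime hp TpH ((TpH.map (TemperedGraphGroupData.exists_completion_of_prop36 S.Gc h36 S.chart).choose_spec.choose.toMonoidHom).topologicalClosure) (Subgroup.le_topologicalClosure _) cuspMeetsH).Cor25Decomposition ∧ (StableCurveTemperedData.ofSpecialFibre X d S h36 Sigma SigmaHat hsub hne hprime hp TpH ((TpH.map (TemperedGraphGroupData.exists_completion_of_prop36 S.Gc h36 S.chart).choose_spec.choose.toMonoidHom).topologicalClosure) (Subgroup.le_topologicalClosure _) cuspMeetsH).Cor25Inertia) ∧ (StableCurveTemperedData.ofSpecialFibre X d S h36 Sigma SigmaHat hsub hne hprime hp TpH ((TpH.map (TemperedGraphGroupData.exists_completion_of_prop36 S.Gc h36 S.chart).choose_spec.choose.toMonoidHom).topologicalClosure) (Subgroup.le_topologicalClosure _) cuspMeetsH).Prop24iii := by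
  haveI : Nonempty X.Pt := ⟨x.1⟩
  haveI : Nonempty {x : X.Pt // X.IsCusp x} := ⟨x⟩
  have h24 := StableCurveTemperedData.OfSpecialFibre.prop24_cor25_ofPiData_of_printedLaws X d T Sigma SigmaHat hsub hne hprime
    S h36 hp TpH
    ((TpH.map (TemperedGraphGroupData.exists_completion_of_prop36 S.Gc h36 S.chart).choose_spec.choose.toMonoidHom).topologicalClosure)
    (Subgroup.le_topologicalClosure _) cuspMeetsH P x hTF Λv hΛv E src tgt c₁ c₂ hA3 hab hadm hLev
  exact layer5_held_sec2_v6_piData X d S h36 Sigma SigmaHat hsub hne hprime hp TpH cuspMeetsH x T P h22 hHstab hA hB hv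
    htp hhat h24.1.1 h24.1.2.1

end Sec2V10

section Cor12V6

open Literature.AnabelianGeometry.AbsoluteAnabelian
open Literature.AnabelianGeometry.AbsoluteAnabelian.FundamentalExtension (CuspidalAlgorithm)
open Literature.AnabelianGeometry.AbsoluteAnabelian.AbsTopII (semiEllipticDoubleCoverSubgroups)

/-! ## Cor 1.2 at the GENUINE K-level datum, v6: `hι'` GROUNDED on abc-iut-L5-t1's typed cusp laws mod `l` (`ModLCuspLaws`) + (rel) + rank -/

/-- **Class (c), [IUTchI] §1 — HELD row Cor 1.2 at the GENUINE K-level datum, v6: v0.9's classical law `hι'` GROUNDED on abc-iut-L5-t1's typed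
cusp laws mod `l`** (closer abc-iut-L5-d4 g8's `InitialThetaData.pe_characteristicNatureOfCoverings_viaX_of_laws`, `PuncturedEllipticCoveringsCor12IotaLawOfLaws.lean`
p448270 over `…CarrowFromXarrow` p447384 and abc-iut-L5-t1's `PuncturedEllipticCoveringsModLCuspLaws` p446054).  Versus v0.9's `layer5_held_cor12_v5`: the
binder `hι'` («an element of `Δ'_C̲ ∖ Δ'_X̲` does not centralise `Δ'_X^{ab} ⊗ 𝔽_l`») is DERIVED from `L' : D'.geom.pe.ModLCuspLaws` (t1's RECORD of the
printed §1 cusp laws (L0)–(L4) mod `l`, a Prop-valued structure: its fields are record-laws printed beside the count), `hIH'` (the (rel)-type law «every cusp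
inertia lies in `H = Ker(Δ_X ↠ Δ_X^{ab} ⊗ ℤ/l)`») and `hrank'` («`[Δ'_X : H'] = l'²`», i.e. `Δ'_X^{ab} ⊗ 𝔽_l ≅ E[l]` has order `l²`), by d4's
`ModLCuspLaws.exists_commutator_not_mem_H` + `CuspGalois.not_deltaXbar_le_H_of_relIndex`.  ALSO (abc-iut-L5-t1's SWAP RECIPE 13:31:05Z, p448117 `arrowCoveringClaims_pe_of_modLCuspLaws`): the printed-claims binders
`h h'` (`ArrowCoveringClaims`, 13 clauses each) are DERIVED from `CG`/`C'` and t1's law records — `hL : D.geom.pe.ModLCuspLaws` (new) and the same `L'` —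
so they LEAVE the list.  LAW binders: `hL L' h0 h0' hΔ hΔ' htf huniq' hext hextC hA hA' hIH' hrank'` = 14 named (v0.9: 13; v0.7: 13) — a re-grounding onto
strictly more primitive printed laws; DATA `C C' A`; `K K' F̄ F̄'`
in universe `0`.  The most-reduced Cor 1.2 count stays with v0's abstract form.  Nothing here asserts that abc is proved or refuted or takes a side on
[IUTchIII] Cor. 3.12; a binder is an assumption label; typed ≠ discharged. -/
theorem layer5_held_cor12_v6
    {F : Type u} {K : Type} {Fbar : Type} [Field F] [NumberField F] [Field K] [NumberField K]
    [Algebra F K] [Field Fbar] [Algebra F Fbar] [Algebra K Fbar]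
    {E : WeierstrassCurve F} [E.IsElliptic] {l : ℕ} {Pb : BadPlacePredicates K}
    (D : InitialThetaData F K Fbar E l Pb)
    {F' : Type u'} {K' : Type} [Field F'] [NumberField F'] [Field K'] [NumberField K'] [Algebra F' K']
    {Fbar' : Type} [Field Fbar'] [Algebra F' Fbar'] [Algebra K' Fbar']
    {E' : WeierstrassCurve F'} [E'.IsElliptic] {l' : ℕ} {Pb' : BadPlacePredicates K'}
    (D' : InitialThetaData F' K' Fbar' E' l' Pb')
    -- DATA: cusp interfaces (abc-iut-L5-t1 `CuspGalois`)
    (C : D.geom.pe.CuspGalois) (C' : D'.geom.pe.CuspGalois)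
    -- LAW: abc-iut-L5-t1's SIX printed cusp laws mod `l` at the unprimed datum (the printed claims of p.38 are DERIVED, p448117)
    (hL : D.geom.pe.ModLCuspLaws)
    -- LAW: the printed ramification of `ε⁰` in `X̲→ → X̲` (GAP-LEDGER G-L5d4g6-1), both data
    (h0 : ¬ D.geom.pe.inertia D.geom.pe.ε0 ≤ D.geom.pe.piXarrow)
    (h0' : ¬ D'.geom.pe.inertia D'.geom.pe.ε0 ≤ D'.geom.pe.piXarrow)
    -- LAW (L4 node BY NAME): [AbsTopI] Prop 2.2 `GeomTFG` at both cores (F-0240)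
    (hΔ : D.geom.pe.E.GeomTFG) (hΔ' : D'.geom.pe.E.GeomTFG)
    -- LAW ([AbsTopII] Cor 3.3 (ii) side conditions): `Δ_X = Π_X ∩ Δ_C` torsion-free (`X` a scheme); uniqueness of the semi-elliptic double cover
    (htf : IsMulTorsionFree ↥(D.geom.pe.PiX ⊓ D.geom.pe.DeltaC))
    (huniq' : ∀ J ∈ semiEllipticDoubleCoverSubgroups D'.geom.pe.E,
      J ⊓ D'.geom.pe.DeltaC = D'.geom.pe.PiX ⊓ D'.geom.pe.DeltaC)
    -- LAW ([AbsTopII] Cor 3.3 (i), pure extension form): every bicontinuous iso of `Π_{X̲→}`'s, resp. `Π_{C̲→}`'s, EXTENDS to the cores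
    (hext : ∀ φ : D.geom.pe.piXarrow ≃* D'.geom.pe.piXarrow, Continuous φ → Continuous φ.symm →
      ∃ Θ : D.geom.pe.PiC ≃ₜ* D'.geom.pe.PiC,
        ∀ x : D.geom.pe.piXarrow, Θ (x : D.geom.pe.PiC) = (φ x : D'.geom.pe.PiC))
    (hextC : ∀ ψ : D.geom.pe.piCarrow ≃* D'.geom.pe.piCarrow, Continuous ψ → Continuous ψ.symm →
      ∃ Θ : D.geom.pe.PiC ≃ₜ* D'.geom.pe.PiC,
        ∀ x : D.geom.pe.piCarrow, Θ (x : D.geom.pe.PiC) = (ψ x : D'.geom.pe.PiC))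
    -- DATA + LAW (L4 node BY NAME): ONE group-theoretic cuspidal algorithm recovering the cusps of `X̲_K` and of `X̲_{K'}` ([AbsTopI] Lem 4.5 (v), F-0206)
    (A : CuspidalAlgorithm.{0}) (hA : A.RecoversCusps D.geom.pe.extXbar C.cuspidalDataXbar)
    (hA' : A.RecoversCusps D'.geom.pe.extXbar C'.cuspidalDataXbar)
    -- LAWS (classical, primed datum only; abc-iut-L5-t1's cusp laws mod `l` + the (rel)-type inclusion + the rank of `Δ'_X^{ab} ⊗ ℤ/l`)
    (L' : D'.geom.pe.ModLCuspLaws)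
    (hIH' : ∀ x : D'.geom.pe.Cusp, D'.geom.pe.inertia x ≤
      (⁅D'.geom.pe.PiX ⊓ D'.geom.pe.DeltaC, D'.geom.pe.PiX ⊓ D'.geom.pe.DeltaC⁆ ⊔
        Subgroup.closure ((fun y : D'.geom.pe.PiC => y ^ D'.geom.pe.l) ''
          (D'.geom.pe.PiX ⊓ D'.geom.pe.DeltaC : Set D'.geom.pe.PiC))).topologicalClosure)
    (hrank' : (⁅D'.geom.pe.PiX ⊓ D'.geom.pe.DeltaC, D'.geom.pe.PiX ⊓ D'.geom.pe.DeltaC⁆ ⊔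
        Subgroup.closure ((fun y : D'.geom.pe.PiC => y ^ D'.geom.pe.l) ''
          (D'.geom.pe.PiX ⊓ D'.geom.pe.DeltaC : Set D'.geom.pe.PiC))).topologicalClosure.relIndex
        (D'.geom.pe.PiX ⊓ D'.geom.pe.DeltaC) = D'.geom.pe.l ^ 2) :
    D.geom.pe.CharacteristicNatureOfCoverings D'.geom.pe :=  -- IUTchI:Cor1.2 at the genuine K-level data; hι' grounded on t1's cusp laws
  D.pe_characteristicNatureOfCoverings_viaX_of_laws D' (D.arrowCoveringClaims_pe_of_modLCuspLaws C hL)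
    (D'.arrowCoveringClaims_pe_of_modLCuspLaws C' L') C C' h0 h0' hΔ hΔ' htf huniq' hext hextC A hA hA' L' hIH' hrank'

end Cor12V6

/-- **THE LAYER-5 CERTIFICATE v10 — SINGLE TOP OF RECORD**: the conjunction, BY NAME via `StatementOf`, of the v9 top `layer5_of_S_v9`
(`Conditional/Layer5OfSV09.lean`, p448341; through it v8 … v0 and the companion) and this module's `layer5_held_sec6_v10_genuineKit_unramified` ((K′)),
`layer5_held_sec2_v10_prop24_piData_printed` ((β″)), `layer5_held_cor12_v6` ((C6)).  CENSUS v10: headline §6 = 3 (+1 record-law in `M'`); most-reduced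
CONE 36 (+2 record-laws in `P`, +1 in `M'`) · FACT 0 · side 15 · NV 3; §6 laws hS hL ΛBad; (β″) 12; Cor 1.2 (C6) 14.  S-FREE.  Nothing here asserts that abc is proved or refuted
or takes a side on [IUTchIII] Cor. 3.12; a binder is an assumption label; typed ≠ discharged; indexed ≠ endorsed. -/
theorem layer5_of_S_v10 :
    Summit.ABC.IUTFork.DAG.PartL5a.StatementOf @layer5_of_S_v9 ∧
    Summit.ABC.IUTFork.DAG.PartL5a.StatementOf @layer5_held_sec6_v10_genuineKit_unramified ∧
    Summit.ABC.IUTFork.DAG.PartL5a.StatementOf @layer5_held_sec2_v10_prop24_piData_printed ∧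
    Summit.ABC.IUTFork.DAG.PartL5a.StatementOf @layer5_held_cor12_v6 :=
  ⟨@layer5_of_S_v9, @layer5_held_sec6_v10_genuineKit_unramified, @layer5_held_sec2_v10_prop24_piData_printed, @layer5_held_cor12_v6⟩

end Summit.ABC.IUTFork.Conditional

/-! ### Build-lane export guard (ops-buildfix bf1-g30, 2026-08-28; G11b-3 recipe v2 as in `GelbartRogawski1991/UnitaryDualPairSeesawCharacter`):
the theorems of this file carry very large dependent telescopes; at `.olean` export Lean 4.32's library-suggestion indexers fold over
every local theorem statement and do not finish within the build lane's one-hour clock (measured on a farm node: `lean -o` > 1 500 s, plain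
elaboration ≈ 20 s). ONE file-final `local` `[implicit_reducible]` keeps them out of that premise index (inert for Meta and the kernel on
theorems; no definition is tagged; statements and proofs unchanged). -/
set_option allowUnsafeReducibility true in
attribute [local implicit_reducible]
  _root_.Summit.ABC.IUTFork.Conditional.layer5_held_sec6_v10_genuineKit_unramified
  _root_.Summit.ABC.IUTFork.Conditional.layer5_held_sec2_v10_prop24_piData_printed
  _root_.Summit.ABC.IUTFork.Conditional.layer5_held_cor12_v6 _root_.Summit.ABC.IUTFork.Conditional.layer5_of_S_v10
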